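import Summits.QuantumFields.BalabanUV.Beta.GAN24.FaceWordEEValueDeep

/-!
# `BalabanUV.Beta.GAN24.FaceWordEEDiagDeep` — binder row G-an2-4 ∕ (CONV-C), W-slot (α-0), ROW (C)sym AT LEVELS `≥ 1`, typer's PART VI row **T6-VAL**, the (γ) hand's
# letter **K7-a (EE sector), DIAGONAL PATTERNS**: **THE PERIOD-`M` STAIRCASE CURRENTS VANISH ON THE DIAGONAL (`ν = β` ∕ `μ = α`) FOR EVERY `M ≥ 1`, HENCE THE E⊗E FACE WORD OF
# THE LEVEL-`(j+1)` FORCING AT THE DEEP PERIOD IS ZERO ON THE DIAGONAL PATTERNS** — gen 53's `StaircaseCurrentAntisymm.stairFace_diag_eq_zero ∕ _fst` with the block period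
# generalised (`⌊s_ν∕M⌋·χ^M_ν(s)` on the leg `ν` is the gradient of a function of `s_ν` alone, which the value Hessian kills), and the diagonal companions of
# `FaceWordEEValueDeep.cellPairing_deep_value(_units)` (G-an2-4 CRUX TEAM (2), seat `b2b-balaban-gan24-formalise-leaf-06` = the (γ) hand, gen 56; journal [GAN24LEAF06-G56-INTENT4])

NOT IN PRINT; OUR BOOKKEEPING ([folklore] BY NAME: gen 53's `StaircaseCurrentAntisymm.tsum_E2_mul_grad_eq_zero_of_quadGrowth ∕ tsum_grad_mul_E2_eq_zero_of_quadGrowth` (E2 kills gradients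
of quadratic growth), K1b `ExitFaceSlotStaircaseDeep.stairN_grad ∕ abs_stairN_le ∕ summable_E2_mul_linGrowth_faceN ∕ summable_linGrowth_faceN_mul_E2 ∕ faceface_e3OfK_eq_stairN ∕ _fst`,
D1 `ValueHessianLinearGauge.tsum_E2_mul_exitFace_eq_zero′ ∕ tsum_exitFace_mul_E2_eq_zero′`, this seat's `FaceWordEEValueDeep.faceface_unitS_smul'`; 0 `def`, 0 cited fact,
0 `def … : Prop`, 0 sorry).  HONEST FRAMING (cell contract, verbatim): «discharging `BetaPertH` makes Bałaban's UV stability UNCONDITIONAL — a real constructive-QFT result; it is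
NOT the continuum limit and NOT the Clay problem.»  HONEST DEPENDENCY (verbatim): «continuum YM on T⁴ ⇐ BetaPertH ∧ nine spine estimates (0/9 proved); BetaPertH ⇐ (D1) ∧ (D4) ∧
CAP+tail; G-an2-4 gates asym, D1 and NE2/3/4.»

WHAT ([folklore]; every `j`, `d`, in-block root, E's pins, any `cΛ`, units `sf sm`, amplitude `cE`, every `M, N ≥ 1`):
* §1 `abs_stairProdM_le`, **`stairFace_diag_eq_zeroM`** (`Σ'_s E2_{j+1}(z,s)_{bν}·⌊s_ν∕M⌋·χ^M_ν(s) = 0`), **`stairFace_diag_eq_zero_fstM`** (first-leg twin);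
* §2 **`cellPairing_deep_eq_zero_of_right_diag`** (`ν = β`) and **`cellPairing_deep_eq_zero_of_left_diag`** (`μ = α`) for the raw table, and `…_units` for `unitS sf sm (cE • V_j)`.
With `FaceWordEEValueDeep` this values the E⊗E face word on ALL patterns.  Asserts NO value of Bałaban's tables; discharges NOTHING of `hX` ∕ `hXu` ∕ (C)_{≥1} ∕ `hB0` ∕ `hBF` ∕
(Q-L) ∕ (hW, hWall); NEVER «G-an2-4 closed» as (CONV-C); NOT D1, NOT `BetaPertH`, NOT continuum, NOT Clay.  2026-08-24; no existing file touched.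
-/

noncomputable section

open Finset
open scoped BigOperators
open Literature.MathematicalPhysics.QuantumFieldTheory
open Literature.MathematicalPhysics.QuantumFieldTheory.Balaban1983to89
open Literature.MathematicalPhysics.QuantumFieldTheory.Balaban1983to89.Beta
open B12Sec2to5 (l1 l1_nonneg)
open ExpKernelCalculus (Site MKer)
open AffineAveraging (box toSite unitVec)
open OneStepResolventKernel (Fib)
open OneStepKernelFamily (KInvStep)
open BalabanStepJetsSucc (E2)
open Summit.QuantumFields.BalabanUV.Beta.AxialDressingRooted (coDressKBmAt one_le_of_neZero)
open Summit.QuantumFields.BalabanUV.Beta.HessKerDressedUnits (unitK unitS)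
open Summit.QuantumFields.BalabanUV.Beta.SpineRooted (e3OfK)
open Summit.QuantumFields.BalabanUV.Beta.WardLocusRecursive (SrecAt)
open Summit.QuantumFields.BalabanUV.Beta.GAN24.ValueHessianLinearGauge (tsum_E2_mul_exitFace_eq_zero' tsum_exitFace_mul_E2_eq_zero')
open Summit.QuantumFields.BalabanUV.Beta.GAN24.StaircaseCurrentAntisymm (tsum_E2_mul_grad_eq_zero_of_quadGrowth tsum_grad_mul_E2_eq_zero_of_quadGrowth)
open Summit.QuantumFields.BalabanUV.Beta.GAN24.ExitFaceSlotStaircaseDeep (stairN_grad abs_stairN_le summable_E2_mul_linGrowth_faceN summable_linGrowth_faceN_mul_E2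
  faceface_e3OfK_eq_stairN faceface_e3OfK_eq_stairN_fst)
open Summit.QuantumFields.BalabanUV.Beta.GAN24.FaceWordEEValueDeep (faceface_unitS_smul')

namespace Summit.QuantumFields.BalabanUV.Beta.GAN24.FaceWordEEDiagDeep

variable {d : ℕ} {Lc : ℕ} [NeZero Lc] {r : Fin (d + 1) → ℕ}

/-! ## §1 The period-`M` staircase currents vanish on the diagonal -/

omit [NeZero Lc] in
/-- [folklore] The product of two period-`M` staircases has quadratic growth: `|⌊y_ν∕M⌋·⌊y_β∕M⌋| ≤ |y|₁²`. -/
theorem abs_stairProdM_le (M : ℕ) (ν β : Fin (d + 1)) (y : Site (d + 1)) :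
    |(((y ν / (M : ℤ) : ℤ) : ℝ)) * (((y β / (M : ℤ) : ℤ) : ℝ))| ≤ 0 + 1 * l1 y ^ 2 := by
  have h1 := abs_stairN_le (d := d) M ν y
  have h2 := abs_stairN_le (d := d) M β y
  rw [zero_add, one_mul] at h1 h2 ⊢
  rw [abs_mul, sq]
  exact mul_le_mul h1 h2 (abs_nonneg _) (l1_nonneg y)

/-- [folklore] **THE PERIOD-`M` SECOND-LEG STAIRCASE CURRENT VANISHES ON THE DIAGONAL** (`β = ν`; every `j`, open leg `(b, z)`, every `M ≥ 1`):
`Σ'_{s′} E2 d Lc (j+1) (z,s′)_{bν}·(⌊s′_ν∕M⌋·χ^M_ν(s′)) = 0` — `E2` kills the gradient of `⌊s_ν∕M⌋²` (quadratic growth), which is `2·⌊s_ν∕M⌋χ^M_ν + χ^M_ν` on the leg `ν`,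
and kills `χ^M_ν` on the leg `ν` (D1). -/
theorem stairFace_diag_eq_zeroM {M : ℕ} (hM : 1 ≤ M) (j : ℕ) (ν : Fin (d + 1)) (z : Site (d + 1)) (b : Fin (d + 1)) :
    (∑' s' : Site (d + 1), E2 d Lc (j + 1) z s' (Sum.inl b) (Sum.inl ν) * ((((s' ν / (M : ℤ) : ℤ) : ℝ)) * (if s' ν % (M : ℤ) = (M : ℤ) - 1 then (1 : ℝ) else 0))) = 0 := by
  have key := tsum_E2_mul_grad_eq_zero_of_quadGrowth (Lc := Lc) (j + 1) b z
    (φ := fun y : Site (d + 1) => (((y ν / (M : ℤ) : ℤ) : ℝ)) * (((y ν / (M : ℤ) : ℤ) : ℝ))) (abs_stairProdM_le M ν ν)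
  have hpt : ∀ s' : Site (d + 1), (∑ l, E2 d Lc (j + 1) z s' (Sum.inl b) (Sum.inl l) *
      ((((( s' + unitVec l) ν / (M : ℤ) : ℤ) : ℝ)) * ((((s' + unitVec l) ν / (M : ℤ) : ℤ) : ℝ)) - (((s' ν / (M : ℤ) : ℤ) : ℝ)) * (((s' ν / (M : ℤ) : ℤ) : ℝ)))) =
      2 * (E2 d Lc (j + 1) z s' (Sum.inl b) (Sum.inl ν) * ((((s' ν / (M : ℤ) : ℤ) : ℝ)) * (if s' ν % (M : ℤ) = (M : ℤ) - 1 then (1 : ℝ) else 0)))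
        + E2 d Lc (j + 1) z s' (Sum.inl b) (Sum.inl ν) * (if s' ν % (M : ℤ) = (M : ℤ) - 1 then (1 : ℝ) else 0) := by
    intro s'
    have eν : ∀ l : Fin (d + 1), ((((s' + unitVec l) ν / (M : ℤ) : ℤ) : ℝ)) =
        (((s' ν / (M : ℤ) : ℤ) : ℝ)) + (if l = ν then (if s' ν % (M : ℤ) = (M : ℤ) - 1 then 1 else 0) else 0) := by
      intro l
      have h := stairN_grad (d := d) hM ν l s'
      linarith
    simp_rw [eν]
    rw [Finset.sum_eq_single ν (fun l _ hl => by rw [if_neg hl]; ring) (fun h => absurd (Finset.mem_univ ν) h), if_pos rfl]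
    split_ifs <;> ring
  rw [tsum_congr hpt] at key
  have h1 := summable_E2_mul_linGrowth_faceN (d := d) (Lc := Lc) j (lam := fun s : Site (d + 1) => (((s ν / (M : ℤ) : ℤ) : ℝ))) (abs_stairN_le M ν) M z b ν
  have h2 : Summable fun s' : Site (d + 1) => E2 d Lc (j + 1) z s' (Sum.inl b) (Sum.inl ν) * (if s' ν % (M : ℤ) = (M : ℤ) - 1 then (1 : ℝ) else 0) := by
    have h := summable_E2_mul_linGrowth_faceN (d := d) (Lc := Lc) j (lam := fun _ : Site (d + 1) => (1 : ℝ)) (A := 1) (B := 0)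
      (fun _ => by rw [zero_mul, add_zero, abs_one]) M z b ν
    exact h.congr fun s' => by rw [one_mul]
  rw [(h1.mul_left 2).tsum_add h2, tsum_mul_left, tsum_E2_mul_exitFace_eq_zero' (Lc := Lc) (j + 1) hM b ν z 1] at key
  linarith

/-- [folklore] **THE PERIOD-`M` FIRST-LEG STAIRCASE CURRENT VANISHES ON THE DIAGONAL** (`α = μ`; open leg `(a, x)`):
`Σ'_y (⌊y_μ∕M⌋·χ^M_μ(y))·E2 d Lc (j+1) (y,x)_{μa} = 0`. -/
theorem stairFace_diag_eq_zero_fstM {M : ℕ} (hM : 1 ≤ M) (j : ℕ) (μ : Fin (d + 1)) (x : Site (d + 1)) (a : Fin (d + 1)) :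
    (∑' y : Site (d + 1), ((((y μ / (M : ℤ) : ℤ) : ℝ)) * (if y μ % (M : ℤ) = (M : ℤ) - 1 then (1 : ℝ) else 0)) * E2 d Lc (j + 1) y x (Sum.inl μ) (Sum.inl a)) = 0 := by
  have key := tsum_grad_mul_E2_eq_zero_of_quadGrowth (Lc := Lc) (j + 1) a x
    (φ := fun y : Site (d + 1) => (((y μ / (M : ℤ) : ℤ) : ℝ)) * (((y μ / (M : ℤ) : ℤ) : ℝ))) (abs_stairProdM_le M μ μ)
  have hpt : ∀ y : Site (d + 1), (∑ κ, ((((( y + unitVec κ) μ / (M : ℤ) : ℤ) : ℝ)) * ((((y + unitVec κ) μ / (M : ℤ) : ℤ) : ℝ))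
      - (((y μ / (M : ℤ) : ℤ) : ℝ)) * (((y μ / (M : ℤ) : ℤ) : ℝ))) * E2 d Lc (j + 1) y x (Sum.inl κ) (Sum.inl a)) =
      2 * (((((y μ / (M : ℤ) : ℤ) : ℝ)) * (if y μ % (M : ℤ) = (M : ℤ) - 1 then (1 : ℝ) else 0)) * E2 d Lc (j + 1) y x (Sum.inl μ) (Sum.inl a))
        + (if y μ % (M : ℤ) = (M : ℤ) - 1 then (1 : ℝ) else 0) * E2 d Lc (j + 1) y x (Sum.inl μ) (Sum.inl a) := by
    intro y
    have eμ : ∀ κ : Fin (d + 1), ((((y + unitVec κ) μ / (M : ℤ) : ℤ) : ℝ)) =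
        (((y μ / (M : ℤ) : ℤ) : ℝ)) + (if κ = μ then (if y μ % (M : ℤ) = (M : ℤ) - 1 then 1 else 0) else 0) := by
      intro κ
      have h := stairN_grad (d := d) hM μ κ y
      linarith
    simp_rw [eμ]
    rw [Finset.sum_eq_single μ (fun l _ hl => by rw [if_neg hl]; ring) (fun h => absurd (Finset.mem_univ μ) h), if_pos rfl]
    split_ifs <;> ring
  rw [tsum_congr hpt] at key
  have h1 := summable_linGrowth_faceN_mul_E2 (d := d) (Lc := Lc) j (lam := fun y : Site (d + 1) => (((y μ / (M : ℤ) : ℤ) : ℝ))) (abs_stairN_le M μ) M x μ a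
  have h2 : Summable fun y : Site (d + 1) => (if y μ % (M : ℤ) = (M : ℤ) - 1 then (1 : ℝ) else 0) * E2 d Lc (j + 1) y x (Sum.inl μ) (Sum.inl a) := by
    have h := summable_linGrowth_faceN_mul_E2 (d := d) (Lc := Lc) j (lam := fun _ : Site (d + 1) => (1 : ℝ)) (A := 1) (B := 0)
      (fun _ => by rw [zero_mul, add_zero, abs_one]) M x μ a
    exact h.congr fun y => by rw [one_mul]
  rw [(h1.mul_left 2).tsum_add h2, tsum_mul_left, tsum_exitFace_mul_E2_eq_zero' (Lc := Lc) (j + 1) hM a μ x 1] at key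
  linarith

/-! ## §2 The E⊗E face word at the deep period vanishes on the diagonal patterns -/

/-- NOT IN PRINT; OUR BOOKKEEPING.  **RIGHT DIAGONAL (`β = ν`): the cell pairing of `FaceWordEEValueDeep.cellPairing_deep_value` is `0`** — the right two-face current is the
diagonal staircase current (K1b), which vanishes (§1). -/
theorem cellPairing_deep_eq_zero_of_right_diag (hr : r ∈ box (d + 1) Lc) (sf sm cΛ : ℝ) (j N : ℕ) [NeZero N] (μ α ν : Fin (d + 1)) :
    ∑ x ∈ box (d + 1) (Lc * N), ∑ a : Fin (d + 1),
        (∑' y : Site (d + 1), (if y α % ((Lc * N : ℕ) : ℤ) = ((Lc * N : ℕ) : ℤ) - 1 then (1 : ℝ) else 0) *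
          ∑' t : Site (d + 1), (if t μ % ((Lc * N : ℕ) : ℤ) = ((Lc * N : ℕ) : ℤ) - 1 then
            e3OfK Lc (coDressKBmAt (toSite r) Lc (KInvStep (d := d) Lc j))
              (SrecAt d Lc (toSite r) ((Lc : ℝ) ^ (d + 1)) (-((Lc : ℝ) ^ (d + 1) * (1 / 2) * (Lc : ℝ) ^ (d + 1))) cΛ j) μ t y (toSite x) (Sum.inl α) (Sum.inl a)
            else 0)) *
        (∑' z : Site (d + 1), ∑ b : Fin (d + 1), unitK sf sm (coDressKBmAt (toSite r) Lc (KInvStep (d := d) Lc (j + 1))) (toSite x) z (Sum.inl a) (Sum.inl b) *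
          (∑' w : Site (d + 1), (if w ν % ((Lc * N : ℕ) : ℤ) = ((Lc * N : ℕ) : ℤ) - 1 then (1 : ℝ) else 0) *
            ∑' t : Site (d + 1), (if t ν % ((Lc * N : ℕ) : ℤ) = ((Lc * N : ℕ) : ℤ) - 1 then
              e3OfK Lc (coDressKBmAt (toSite r) Lc (KInvStep (d := d) Lc j))
                (SrecAt d Lc (toSite r) ((Lc : ℝ) ^ (d + 1)) (-((Lc : ℝ) ^ (d + 1) * (1 / 2) * (Lc : ℝ) ^ (d + 1))) cΛ j) ν t z w (Sum.inl b) (Sum.inl ν)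
              else 0))) = 0 := by
  have hM : 1 ≤ Lc * N := Nat.mul_pos (one_le_of_neZero Lc) (one_le_of_neZero N)
  refine Finset.sum_eq_zero fun x _ => Finset.sum_eq_zero fun a _ => ?_
  have hR : ∀ (z : Site (d + 1)) (b : Fin (d + 1)),
      (∑' w : Site (d + 1), (if w ν % ((Lc * N : ℕ) : ℤ) = ((Lc * N : ℕ) : ℤ) - 1 then (1 : ℝ) else 0) *
        ∑' t : Site (d + 1), (if t ν % ((Lc * N : ℕ) : ℤ) = ((Lc * N : ℕ) : ℤ) - 1 then
          e3OfK Lc (coDressKBmAt (toSite r) Lc (KInvStep (d := d) Lc j))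
            (SrecAt d Lc (toSite r) ((Lc : ℝ) ^ (d + 1)) (-((Lc : ℝ) ^ (d + 1) * (1 / 2) * (Lc : ℝ) ^ (d + 1))) cΛ j) ν t z w (Sum.inl b) (Sum.inl ν)
          else 0)) = 0 := by
    intro z b
    rw [faceface_e3OfK_eq_stairN hr cΛ j hM hM ν ν z b, stairFace_diag_eq_zeroM (Lc := Lc) hM j ν z b, mul_zero]
  simp_rw [hR, mul_zero, Finset.sum_const_zero, tsum_zero, mul_zero]

/-- NOT IN PRINT; OUR BOOKKEEPING.  **LEFT DIAGONAL (`α = μ`): the cell pairing is `0`** — the left two-face current is the diagonal first-leg staircase current (K1b), which vanishes (§1). -/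
theorem cellPairing_deep_eq_zero_of_left_diag (hr : r ∈ box (d + 1) Lc) (sf sm cΛ : ℝ) (j N : ℕ) [NeZero N] (μ ν β : Fin (d + 1)) :
    ∑ x ∈ box (d + 1) (Lc * N), ∑ a : Fin (d + 1),
        (∑' y : Site (d + 1), (if y μ % ((Lc * N : ℕ) : ℤ) = ((Lc * N : ℕ) : ℤ) - 1 then (1 : ℝ) else 0) *
          ∑' t : Site (d + 1), (if t μ % ((Lc * N : ℕ) : ℤ) = ((Lc * N : ℕ) : ℤ) - 1 then
            e3OfK Lc (coDressKBmAt (toSite r) Lc (KInvStep (d := d) Lc j))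
              (SrecAt d Lc (toSite r) ((Lc : ℝ) ^ (d + 1)) (-((Lc : ℝ) ^ (d + 1) * (1 / 2) * (Lc : ℝ) ^ (d + 1))) cΛ j) μ t y (toSite x) (Sum.inl μ) (Sum.inl a)
            else 0)) *
        (∑' z : Site (d + 1), ∑ b : Fin (d + 1), unitK sf sm (coDressKBmAt (toSite r) Lc (KInvStep (d := d) Lc (j + 1))) (toSite x) z (Sum.inl a) (Sum.inl b) *
          (∑' w : Site (d + 1), (if w β % ((Lc * N : ℕ) : ℤ) = ((Lc * N : ℕ) : ℤ) - 1 then (1 : ℝ) else 0) *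
            ∑' t : Site (d + 1), (if t ν % ((Lc * N : ℕ) : ℤ) = ((Lc * N : ℕ) : ℤ) - 1 then
              e3OfK Lc (coDressKBmAt (toSite r) Lc (KInvStep (d := d) Lc j))
                (SrecAt d Lc (toSite r) ((Lc : ℝ) ^ (d + 1)) (-((Lc : ℝ) ^ (d + 1) * (1 / 2) * (Lc : ℝ) ^ (d + 1))) cΛ j) ν t z w (Sum.inl b) (Sum.inl β)
              else 0))) = 0 := by
  have hM : 1 ≤ Lc * N := Nat.mul_pos (one_le_of_neZero Lc) (one_le_of_neZero N)
  refine Finset.sum_eq_zero fun x _ => Finset.sum_eq_zero fun a _ => ?_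
  rw [faceface_e3OfK_eq_stairN_fst hr cΛ j hM hM μ μ (toSite x) a, stairFace_diag_eq_zero_fstM (Lc := Lc) hM j μ (toSite x) a, mul_zero, zero_mul]

/-- NOT IN PRINT; OUR BOOKKEEPING.  **RIGHT DIAGONAL, unit-scaled table** `unitS sf sm (cE • V_j)`: the cell pairing is `0`. -/
theorem cellPairing_deep_eq_zero_of_right_diag_units (hr : r ∈ box (d + 1) Lc) (sf sm cE cΛ : ℝ) (j N : ℕ) [NeZero N] (μ α ν : Fin (d + 1)) :
    ∑ x ∈ box (d + 1) (Lc * N), ∑ a : Fin (d + 1),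
        (∑' y : Site (d + 1), (if y α % ((Lc * N : ℕ) : ℤ) = ((Lc * N : ℕ) : ℤ) - 1 then (1 : ℝ) else 0) *
          ∑' t : Site (d + 1), (if t μ % ((Lc * N : ℕ) : ℤ) = ((Lc * N : ℕ) : ℤ) - 1 then
            unitS sf sm (fun κ u => cE • e3OfK Lc (coDressKBmAt (toSite r) Lc (KInvStep (d := d) Lc j))
              (SrecAt d Lc (toSite r) ((Lc : ℝ) ^ (d + 1)) (-((Lc : ℝ) ^ (d + 1) * (1 / 2) * (Lc : ℝ) ^ (d + 1))) cΛ j) κ u) μ t y (toSite x) (Sum.inl α) (Sum.inl a)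
            else 0)) *
        (∑' z : Site (d + 1), ∑ b : Fin (d + 1), unitK sf sm (coDressKBmAt (toSite r) Lc (KInvStep (d := d) Lc (j + 1))) (toSite x) z (Sum.inl a) (Sum.inl b) *
          (∑' w : Site (d + 1), (if w ν % ((Lc * N : ℕ) : ℤ) = ((Lc * N : ℕ) : ℤ) - 1 then (1 : ℝ) else 0) *
            ∑' t : Site (d + 1), (if t ν % ((Lc * N : ℕ) : ℤ) = ((Lc * N : ℕ) : ℤ) - 1 then
              unitS sf sm (fun κ u => cE • e3OfK Lc (coDressKBmAt (toSite r) Lc (KInvStep (d := d) Lc j))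
                (SrecAt d Lc (toSite r) ((Lc : ℝ) ^ (d + 1)) (-((Lc : ℝ) ^ (d + 1) * (1 / 2) * (Lc : ℝ) ^ (d + 1))) cΛ j) κ u) ν t z w (Sum.inl b) (Sum.inl ν)
              else 0))) = 0 := by
  have hM : 1 ≤ Lc * N := Nat.mul_pos (one_le_of_neZero Lc) (one_le_of_neZero N)
  refine Finset.sum_eq_zero fun x _ => Finset.sum_eq_zero fun a _ => ?_
  have hR : ∀ (z : Site (d + 1)) (b : Fin (d + 1)),
      (∑' w : Site (d + 1), (if w ν % ((Lc * N : ℕ) : ℤ) = ((Lc * N : ℕ) : ℤ) - 1 then (1 : ℝ) else 0) *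
        ∑' t : Site (d + 1), (if t ν % ((Lc * N : ℕ) : ℤ) = ((Lc * N : ℕ) : ℤ) - 1 then
          unitS sf sm (fun κ u => cE • e3OfK Lc (coDressKBmAt (toSite r) Lc (KInvStep (d := d) Lc j))
            (SrecAt d Lc (toSite r) ((Lc : ℝ) ^ (d + 1)) (-((Lc : ℝ) ^ (d + 1) * (1 / 2) * (Lc : ℝ) ^ (d + 1))) cΛ j) κ u) ν t z w (Sum.inl b) (Sum.inl ν)
          else 0)) = 0 := by
    intro z b
    rw [faceface_unitS_smul' sf sm cE _ ν (fun t : Site (d + 1) => t ν % ((Lc * N : ℕ) : ℤ) = ((Lc * N : ℕ) : ℤ) - 1)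
        (fun w : Site (d + 1) => (if w ν % ((Lc * N : ℕ) : ℤ) = ((Lc * N : ℕ) : ℤ) - 1 then (1 : ℝ) else 0)) (fun _ => z) (fun w => w) b ν,
      faceface_e3OfK_eq_stairN hr cΛ j hM hM ν ν z b, stairFace_diag_eq_zeroM (Lc := Lc) hM j ν z b, mul_zero, mul_zero]
  simp_rw [hR, mul_zero, Finset.sum_const_zero, tsum_zero, mul_zero]

/-- NOT IN PRINT; OUR BOOKKEEPING.  **LEFT DIAGONAL, unit-scaled table**: the cell pairing is `0`. -/
theorem cellPairing_deep_eq_zero_of_left_diag_units (hr : r ∈ box (d + 1) Lc) (sf sm cE cΛ : ℝ) (j N : ℕ) [NeZero N] (μ ν β : Fin (d + 1)) :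
    ∑ x ∈ box (d + 1) (Lc * N), ∑ a : Fin (d + 1),
        (∑' y : Site (d + 1), (if y μ % ((Lc * N : ℕ) : ℤ) = ((Lc * N : ℕ) : ℤ) - 1 then (1 : ℝ) else 0) *
          ∑' t : Site (d + 1), (if t μ % ((Lc * N : ℕ) : ℤ) = ((Lc * N : ℕ) : ℤ) - 1 then
            unitS sf sm (fun κ u => cE • e3OfK Lc (coDressKBmAt (toSite r) Lc (KInvStep (d := d) Lc j))
              (SrecAt d Lc (toSite r) ((Lc : ℝ) ^ (d + 1)) (-((Lc : ℝ) ^ (d + 1) * (1 / 2) * (Lc : ℝ) ^ (d + 1))) cΛ j) κ u) μ t y (toSite x) (Sum.inl μ) (Sum.inl a)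
            else 0)) *
        (∑' z : Site (d + 1), ∑ b : Fin (d + 1), unitK sf sm (coDressKBmAt (toSite r) Lc (KInvStep (d := d) Lc (j + 1))) (toSite x) z (Sum.inl a) (Sum.inl b) *
          (∑' w : Site (d + 1), (if w β % ((Lc * N : ℕ) : ℤ) = ((Lc * N : ℕ) : ℤ) - 1 then (1 : ℝ) else 0) *
            ∑' t : Site (d + 1), (if t ν % ((Lc * N : ℕ) : ℤ) = ((Lc * N : ℕ) : ℤ) - 1 then
              unitS sf sm (fun κ u => cE • e3OfK Lc (coDressKBmAt (toSite r) Lc (KInvStep (d := d) Lc j))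
                (SrecAt d Lc (toSite r) ((Lc : ℝ) ^ (d + 1)) (-((Lc : ℝ) ^ (d + 1) * (1 / 2) * (Lc : ℝ) ^ (d + 1))) cΛ j) κ u) ν t z w (Sum.inl b) (Sum.inl β)
              else 0))) = 0 := by
  have hM : 1 ≤ Lc * N := Nat.mul_pos (one_le_of_neZero Lc) (one_le_of_neZero N)
  refine Finset.sum_eq_zero fun x _ => Finset.sum_eq_zero fun a _ => ?_
  rw [faceface_unitS_smul' sf sm cE _ μ (fun t : Site (d + 1) => t μ % ((Lc * N : ℕ) : ℤ) = ((Lc * N : ℕ) : ℤ) - 1)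
      (fun y : Site (d + 1) => (if y μ % ((Lc * N : ℕ) : ℤ) = ((Lc * N : ℕ) : ℤ) - 1 then (1 : ℝ) else 0)) (fun y => y) (fun _ => toSite x) μ a,
    faceface_e3OfK_eq_stairN_fst hr cΛ j hM hM μ μ (toSite x) a, stairFace_diag_eq_zero_fstM (Lc := Lc) hM j μ (toSite x) a, mul_zero, mul_zero, zero_mul]

end Summit.QuantumFields.BalabanUV.Beta.GAN24.FaceWordEEDiagDeep

end
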